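import Mathlib
import Summits.NavierStokesRegularity.NavierStokesRegularity.Theorems.EulerZoomLiouvillePowerGaugeEulerLiouvillePressureFloorBumpHessian
import HarnessLib

/-!
# Crux `EulerZoomLiouville.PowerGaugeEulerLiouville` (stmt-NavierStokesRegularity-19832), line `pressure-floor`, stub A2 — brick 5:
# THE NEWTONIAN BUMP FAMILY EXISTS (`stub_newtonianBumps`, signature unfolded)

Route №10 `EulerZoomLiouville` (NavierStokesRegularity), crux E.  Line `pressure-floor` (ideator ns-idea-11;
`Cruxes/PowerGaugeEulerLiouville/Lines/pressure_floor.lean`), registered stub `stub_newtonianBumps` (A2, «RADIAL NEWTONIAN CALCULUS,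
pure real analysis, no fluid content»), proved here with its signature UNFOLDED in the tree's vocabulary (the line's
`IsNewtonianWeight`, `powerProfile`, `NewtonianBumpFamily` are `def`s of the Cruxes file; the statement below is their
`δ`-unfolding, so the skeleton fills the stub by `exact`).  Seat ns-ezl-w3 (W-PF1/A2, DIRECTOR-NS #162); bricks 1–4:
`…PressureFloorShellMean` (ns-sfl-p1), `…ShellTransform`, `…BumpProfile`, `…BumpHessian`.

THE STATEMENT.  For every `β ∈ [0,1)` there is `C = C_β` such that for every `R ≥ 1` there is a NEWTONIAN WEIGHT `Ψ = Ψ_R`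
(smooth, `|Ψ| ≤ K/(1+|x|)`, `|∇Ψ| ≤ K/(1+|x|)²`, `|D²Ψ(x)(v,v)| ≤ K|v|²/(1+|x|)³`) with `0 ≤ ΔΨ ≤ w_β = (1+|x|²)^{−β/2}`,
`ΔΨ = w_β` on `|x| ≤ R`, `ΔΨ = 0` for `|x| ≥ 2R`, PINCHED Hessian `((1−β)/(3−β)) w_β|v|² ≤ D²Ψ(v,v) ≤ w_β|v|²/(3−β)` on `|x| ≤ R`,
and TIDAL bound `|D²Ψ(x)(v,v)| ≤ C R^{3−β}|x|^{−3}|v|²` for `|x| ≥ R`.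

THE CONSTRUCTION.  `Ψ(x) = g(|x|²)` where, in the variable `σ = |x|²`: `ρ` is the cut density of brick 2 (`= w_β` on `[0,R²]`,
`= 0` beyond `2R²`), `h(σ) = ½∫₀¹ t²ρ(σt²)dt` its shell transform (`4σh' + 6h = ρ`, i.e. `ΔΨ = ρ(|x|²)`), and `g` the primitive of
`h` normalised by `g(2R²) = −2Q₀(2R²)^{−1/2}` (`Q₀ = (2R²)^{3/2}h(2R²)` the total mass), so that `Ψ = −2Q₀/|x|` beyond `|x| = √2 R`
(brick 3).  `C_β = 2^{(3−β)/2}(4/(3−β) + 1)`.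

* `radialBump_newtonianDecay` — the three decay bounds with `K = K(R)` (inside `|x|² ≤ 2R²`: `|g| ≤ B`, `h ≤ 1/6`, `ρ ≤ 1`;
  outside: the exact Newtonian tail `g = −2Q₀σ^{−1/2}`, `h = Q₀σ^{−3/2}`, `ρ = 0`);
* **`newtonianBumps`** — the stub signature, unfolded.

WHAT THIS IS NOT: not NS, not the crux — a helper `--supports` stmt-19832 on the line `pressure-floor`; 19832 is a crux CLASS of
Euler/NS strata and stays OPEN (A3/A4 are ns-ezl-w2's, A5 is the open residue); nothing here bears on NS regularity. [folklore]
-/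

noncomputable section

-- flat `Theorems/<Route><Decl>…` files of one crux share the namespace of the crux (tree convention)
set_option linter.dupNamespace false

open MeasureTheory Set Filter Topology intervalIntegral InnerProductSpace
open scoped ContDiff Topology RealInnerProductSpace Laplacian

namespace Summit.NavierStokesRegularity.NavierStokesRegularity.Theorems.PowerGaugeEulerLiouville.PressureFloor

open Literature.Analysis.FluidPDE

variable {ρ h g : ℝ → ℝ}

/-! ### Newtonian decay of the radial bump -/

/-- **Newtonian decay of `Ψ = g(|x|²)`.**  For the cut density `ρ` of brick 2, its shell transform `h` and the primitive `g` of
`h` normalised by `g(2R²) = −2 Q₀ (2R²)^{−1/2}` (`Q₀ = (2R²)^{3/2} h(2R²)`), there is `K` with `|Ψ(x)| ≤ K/(1+|x|)`,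
`‖DΨ(x)‖ ≤ K/(1+|x|)²`, `|D²Ψ(x)(v,v)| ≤ K|v|²/(1+|x|)³` for all `x, v`.  Inside `|x|² ≤ 2R²`: `|g| ≤ B` (brick 3),
`‖DΨ‖ ≤ 2h|x| ≤ 2R/3` (`h ≤ 1/6`, brick 2) and `|D²Ψ(v,v)| ≤ (8h + ρ)|v|² ≤ (7/3)|v|²` (brick 4), while `1 + |x| ≤ 1 + 2R`;
outside: `Ψ = −2Q₀/|x|`, `h = Q₀|x|^{−3}`, `ρ = 0` (brick 3), while `1 + |x| ≤ 2|x|`. [folklore] -/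
theorem radialBump_newtonianDecay {β R : ℝ} (hβ : 0 ≤ β) (hR : 1 ≤ R) (hρ : ContDiff ℝ ∞ ρ)
    (hρ0 : ∀ s, 0 ≤ ρ s) (hρW : ∀ s, 0 ≤ s → ρ s ≤ (1 + s) ^ (-(β / 2)))
    (hρz : ∀ s, 2 * R ^ 2 ≤ s → ρ s = 0)
    (hh : h = fun σ => 2⁻¹ * ∫ t in (0 : ℝ)..1, t ^ 2 * ρ (σ * t ^ 2))
    (hg : ∀ σ, HasDerivAt g (h σ) σ)
    (hga : g (2 * R ^ 2) =
      -2 * ((2 * R ^ 2) ^ ((3 : ℝ) / 2) * h (2 * R ^ 2)) * (2 * R ^ 2) ^ (-((1 : ℝ) / 2))) :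
    ∃ K : ℝ, ∀ x : EuclideanSpace ℝ (Fin 3),
      |g (‖x‖ ^ 2)| ≤ K / (1 + ‖x‖) ∧
        ‖fderiv ℝ (fun w : EuclideanSpace ℝ (Fin 3) => g (‖w‖ ^ 2)) x‖ ≤ K / (1 + ‖x‖) ^ 2 ∧
          ∀ v : EuclideanSpace ℝ (Fin 3),
            |fderiv ℝ (fderiv ℝ (fun w : EuclideanSpace ℝ (Fin 3) => g (‖w‖ ^ 2))) x v v| ≤
              K / (1 + ‖x‖) ^ 3 * ‖v‖ ^ 2 := by
  have hR0 : 0 < R := by linarith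
  set a : ℝ := 2 * R ^ 2 with ha
  have ha0 : 0 < a := by positivity
  have ha2 : 2 ≤ a := by rw [ha]; nlinarith
  set Q₀ : ℝ := a ^ ((3 : ℝ) / 2) * h a with hQ₀
  have hh0 : ∀ s, 0 ≤ h s := shellTransform_nonneg hρ0 hh
  have hQ₀0 : 0 ≤ Q₀ := mul_nonneg (Real.rpow_nonneg ha0.le _) (hh0 a)
  obtain ⟨B, hB0, hB⟩ := exists_bound_primitive hg a
  set A : ℝ := 1 + 2 * R with hA
  -- the exterior tail (brick 3)
  have htail : ∀ s, a ≤ s → h s = Q₀ * s ^ (-((3 : ℝ) / 2)) := fun s hs =>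
    shellTransform_eq_tail hρ hρ0 ha0 hρz hh hs
  have hgtail : ∀ s, a ≤ s → g s = -2 * Q₀ * s ^ (-((1 : ℝ) / 2)) := fun s hs =>
    primitive_eq_tail ha0 hg htail hga hs
  -- the interior bounds (brick 2)
  have hρ1 : ∀ s, 0 ≤ s → ρ s ≤ 1 := fun s hs =>
    (hρW s hs).trans (Real.rpow_le_one_of_one_le_of_nonpos (by linarith) (by linarith))
  have hsixth : ∀ s, 0 ≤ s → h s ≤ 1 / 6 := fun s hs => shellTransform_le_sixth hρ.continuous hρ1 hh hs
  -- the constant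
  have hK1 : 0 ≤ B * A := by positivity
  have hK2 : 0 ≤ 2 * R / 3 * A ^ 2 := by positivity
  have hK3 : 0 ≤ 7 / 3 * A ^ 3 := by positivity
  refine ⟨B * A + 2 * R / 3 * A ^ 2 + 7 / 3 * A ^ 3 + 64 * Q₀, fun x => ?_⟩
  have hr0 : 0 ≤ ‖x‖ := norm_nonneg x
  have h1r : 0 < 1 + ‖x‖ := by positivity
  have hσ0 : 0 ≤ ‖x‖ ^ 2 := by positivity
  rcases le_or_gt (‖x‖ ^ 2) a with hσa | hσa
  · -- INTERIOR `|x|² ≤ 2R²`: `|x| ≤ 2R`, so `1 + |x| ≤ A`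
    have hx2R : ‖x‖ ≤ 2 * R := by
      have h4 : ‖x‖ ^ 2 ≤ (2 * R) ^ 2 := by rw [ha] at hσa; nlinarith
      exact (pow_le_pow_iff_left₀ hr0 (by positivity) two_ne_zero).1 h4
    have hAx : 1 + ‖x‖ ≤ A := by rw [hA]; linarith
    have hlift : ∀ (b : ℝ) (k : ℕ), 0 ≤ b → b ≤ b * A ^ k / (1 + ‖x‖) ^ k := fun b k hb => by
      rw [le_div_iff₀ (pow_pos h1r k)]
      exact mul_le_mul_of_nonneg_left (pow_le_pow_left₀ h1r.le hAx k) hb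
    refine ⟨?_, ?_, ?_⟩
    · have h1 : |g (‖x‖ ^ 2)| ≤ B := hB _ ⟨hσ0, hσa⟩
      have h2 := hlift B 1 hB0
      rw [pow_one, pow_one] at h2
      calc |g (‖x‖ ^ 2)| ≤ B * A / (1 + ‖x‖) := h1.trans h2
        _ ≤ (B * A + 2 * R / 3 * A ^ 2 + 7 / 3 * A ^ 3 + 64 * Q₀) / (1 + ‖x‖) :=
            div_le_div_of_nonneg_right (by linarith) h1r.le
    · have h1 := norm_fderiv_radialBump_le hg x
      have h2 : 2 * |h (‖x‖ ^ 2)| * ‖x‖ ≤ 2 * R / 3 := by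
        rw [abs_of_nonneg (hh0 _)]
        have := hsixth _ hσ0
        have := hh0 (‖x‖ ^ 2)
        nlinarith
      calc ‖fderiv ℝ (fun w : EuclideanSpace ℝ (Fin 3) => g (‖w‖ ^ 2)) x‖ ≤ 2 * R / 3 := h1.trans h2
        _ ≤ 2 * R / 3 * A ^ 2 / (1 + ‖x‖) ^ 2 := hlift (2 * R / 3) 2 (by positivity)
        _ ≤ (B * A + 2 * R / 3 * A ^ 2 + 7 / 3 * A ^ 3 + 64 * Q₀) / (1 + ‖x‖) ^ 2 :=
            div_le_div_of_nonneg_right (by linarith) (pow_pos h1r 2).le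
    · intro v
      have h1 := abs_hessian_radialBump_le hρ hρ0 hh hg x v
      have h2 : 8 * h (‖x‖ ^ 2) + ρ (‖x‖ ^ 2) ≤ 7 / 3 := by
        have := hsixth _ hσ0
        have := hρ1 _ hσ0
        linarith
      calc |fderiv ℝ (fderiv ℝ (fun w : EuclideanSpace ℝ (Fin 3) => g (‖w‖ ^ 2))) x v v|
          ≤ (8 * h (‖x‖ ^ 2) + ρ (‖x‖ ^ 2)) * ‖v‖ ^ 2 := h1
        _ ≤ 7 / 3 * ‖v‖ ^ 2 := mul_le_mul_of_nonneg_right h2 (sq_nonneg _)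
        _ ≤ 7 / 3 * A ^ 3 / (1 + ‖x‖) ^ 3 * ‖v‖ ^ 2 :=
            mul_le_mul_of_nonneg_right (hlift (7 / 3) 3 (by norm_num)) (sq_nonneg _)
        _ ≤ (B * A + 2 * R / 3 * A ^ 2 + 7 / 3 * A ^ 3 + 64 * Q₀) / (1 + ‖x‖) ^ 3 * ‖v‖ ^ 2 :=
            mul_le_mul_of_nonneg_right (div_le_div_of_nonneg_right (by linarith) (pow_pos h1r 3).le)
              (sq_nonneg _)
  · -- EXTERIOR `|x|² > 2R² ≥ 2`: `|x| ≥ 1`, so `1 + |x| ≤ 2|x|`, and the Newtonian tail is exact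
    have hx1 : 1 ≤ ‖x‖ := by nlinarith
    have hxpos : 0 < ‖x‖ := by linarith
    have h2x : 1 + ‖x‖ ≤ 2 * ‖x‖ := by linarith
    have hlift : ∀ (c : ℝ) (k : ℕ), 0 ≤ c → c * (‖x‖ ^ k)⁻¹ ≤ 2 ^ k * c / (1 + ‖x‖) ^ k := fun c k hc => by
      rw [le_div_iff₀ (pow_pos h1r k), ← div_eq_mul_inv, div_mul_eq_mul_div, div_le_iff₀ (pow_pos hxpos k)]
      calc c * (1 + ‖x‖) ^ k ≤ c * (2 * ‖x‖) ^ k :=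
            mul_le_mul_of_nonneg_left (pow_le_pow_left₀ h1r.le h2x k) hc
        _ = 2 ^ k * c * ‖x‖ ^ k := by rw [mul_pow]; ring
    -- `σ^{-1/2} = |x|^{-1}`, `σ^{-3/2} = |x|^{-3}`
    have eσ1 : (‖x‖ ^ 2) ^ (-((1 : ℝ) / 2)) = (‖x‖ ^ 1)⁻¹ := by
      rw [← Real.rpow_two, ← Real.rpow_mul hr0,
        show (2 : ℝ) * (-((1 : ℝ) / 2)) = -(((1 : ℕ) : ℝ)) by norm_num, Real.rpow_neg hr0, Real.rpow_natCast]
    have eσ3 : (‖x‖ ^ 2) ^ (-((3 : ℝ) / 2)) = (‖x‖ ^ 3)⁻¹ := by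
      rw [← Real.rpow_two, ← Real.rpow_mul hr0,
        show (2 : ℝ) * (-((3 : ℝ) / 2)) = -(((3 : ℕ) : ℝ)) by norm_num, Real.rpow_neg hr0, Real.rpow_natCast]
    have hhx : h (‖x‖ ^ 2) = Q₀ * (‖x‖ ^ 3)⁻¹ := by rw [htail _ hσa.le, eσ3]
    have hgx : g (‖x‖ ^ 2) = -2 * Q₀ * (‖x‖ ^ 1)⁻¹ := by rw [hgtail _ hσa.le, eσ1]
    have hρx : ρ (‖x‖ ^ 2) = 0 := hρz _ hσa.le
    refine ⟨?_, ?_, ?_⟩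
    · rw [hgx]
      have h1 : |-2 * Q₀ * (‖x‖ ^ 1)⁻¹| = 2 * Q₀ * (‖x‖ ^ 1)⁻¹ := by
        rw [abs_mul, abs_mul, abs_of_nonneg hQ₀0, abs_of_nonneg (inv_nonneg.2 (pow_nonneg hr0 1))]
        norm_num
      calc |-2 * Q₀ * (‖x‖ ^ 1)⁻¹| = 2 * Q₀ * (‖x‖ ^ 1)⁻¹ := h1
        _ ≤ 2 ^ 1 * (2 * Q₀) / (1 + ‖x‖) ^ 1 := hlift _ 1 (by positivity)
        _ = 4 * Q₀ / (1 + ‖x‖) := by rw [pow_one, pow_one]; ring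
        _ ≤ (B * A + 2 * R / 3 * A ^ 2 + 7 / 3 * A ^ 3 + 64 * Q₀) / (1 + ‖x‖) :=
            div_le_div_of_nonneg_right (by linarith) h1r.le
    · have h1 := norm_fderiv_radialBump_le hg x
      rw [hhx, abs_of_nonneg (by positivity)] at h1
      have e : 2 * (Q₀ * (‖x‖ ^ 3)⁻¹) * ‖x‖ = 2 * Q₀ * (‖x‖ ^ 2)⁻¹ := by
        field_simp
      rw [e] at h1
      calc ‖fderiv ℝ (fun w : EuclideanSpace ℝ (Fin 3) => g (‖w‖ ^ 2)) x‖ ≤ 2 * Q₀ * (‖x‖ ^ 2)⁻¹ := h1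
        _ ≤ 2 ^ 2 * (2 * Q₀) / (1 + ‖x‖) ^ 2 := hlift _ 2 (by positivity)
        _ = 8 * Q₀ / (1 + ‖x‖) ^ 2 := by ring
        _ ≤ (B * A + 2 * R / 3 * A ^ 2 + 7 / 3 * A ^ 3 + 64 * Q₀) / (1 + ‖x‖) ^ 2 :=
            div_le_div_of_nonneg_right (by linarith) (pow_pos h1r 2).le
    · intro v
      have h1 := abs_hessian_radialBump_le hρ hρ0 hh hg x v
      rw [hhx, hρx, add_zero] at h1
      have h2 : 8 * (Q₀ * (‖x‖ ^ 3)⁻¹) ≤ 2 ^ 3 * (8 * Q₀) / (1 + ‖x‖) ^ 3 := by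
        have := hlift (8 * Q₀) 3 (by positivity)
        rw [show 8 * (Q₀ * (‖x‖ ^ 3)⁻¹) = 8 * Q₀ * (‖x‖ ^ 3)⁻¹ by ring]
        exact this
      calc |fderiv ℝ (fderiv ℝ (fun w : EuclideanSpace ℝ (Fin 3) => g (‖w‖ ^ 2))) x v v|
          ≤ 8 * (Q₀ * (‖x‖ ^ 3)⁻¹) * ‖v‖ ^ 2 := h1
        _ ≤ 2 ^ 3 * (8 * Q₀) / (1 + ‖x‖) ^ 3 * ‖v‖ ^ 2 := mul_le_mul_of_nonneg_right h2 (sq_nonneg _)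
        _ = 64 * Q₀ / (1 + ‖x‖) ^ 3 * ‖v‖ ^ 2 := by ring
        _ ≤ (B * A + 2 * R / 3 * A ^ 2 + 7 / 3 * A ^ 3 + 64 * Q₀) / (1 + ‖x‖) ^ 3 * ‖v‖ ^ 2 :=
            mul_le_mul_of_nonneg_right (div_le_div_of_nonneg_right (by linarith) (pow_pos h1r 3).le)
              (sq_nonneg _)

/-! ### The stub, unfolded -/

/-- **A2 `stub_newtonianBumps` of the line `pressure-floor`, signature unfolded** (`NewtonianBumpFamily β`, `IsNewtonianWeight Ψ`,
`powerProfile β x = (1 + |x|²)^{−β/2}` are the line's abbreviations): for every `β ∈ [0, 1)` there is `C` (here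
`C = 2^{(3−β)/2}(4/(3−β) + 1)`) such that for every `R ≥ 1` a Newtonian weight `Ψ` exists whose Laplacian is a compactly supported
cut-off of the profile (`0 ≤ ΔΨ ≤ w_β`, `= w_β` on `B_R`, `= 0` off `B_{2R}`), whose Hessian is pinched on `B_R`
(`((1−β)/(3−β)) w_β|v|² ≤ D²Ψ(v,v) ≤ w_β|v|²/(3−β)`) and tidal outside (`|D²Ψ(x)(v,v)| ≤ C R^{3−β}|x|^{−3}|v|²`, `|x| ≥ R`).
Construction `Ψ(x) = g(|x|²)` with the cut density, shell transform and normalised primitive of bricks 2–3; Laplacian,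
pinching and tidal bounds from brick 4; decay from `radialBump_newtonianDecay`. [folklore] -/
theorem newtonianBumps :
    ∀ β : ℝ, 0 ≤ β → β < 1 →
      ∃ C : ℝ, ∀ R : ℝ, 1 ≤ R → ∃ Ψ : EuclideanSpace ℝ (Fin 3) → ℝ,
        (ContDiff ℝ ∞ Ψ ∧ ∃ K : ℝ, ∀ x : EuclideanSpace ℝ (Fin 3),
          |Ψ x| ≤ K / (1 + ‖x‖) ∧ ‖fderiv ℝ Ψ x‖ ≤ K / (1 + ‖x‖) ^ 2 ∧
            ∀ v : EuclideanSpace ℝ (Fin 3),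
              |fderiv ℝ (fderiv ℝ Ψ) x v v| ≤ K / (1 + ‖x‖) ^ 3 * ‖v‖ ^ 2) ∧
        (∀ x : EuclideanSpace ℝ (Fin 3), 0 ≤ Δ Ψ x ∧ Δ Ψ x ≤ (1 + ‖x‖ ^ 2) ^ (-(β / 2))) ∧
        (∀ x : EuclideanSpace ℝ (Fin 3), ‖x‖ ≤ R → Δ Ψ x = (1 + ‖x‖ ^ 2) ^ (-(β / 2))) ∧
        (∀ x : EuclideanSpace ℝ (Fin 3), 2 * R ≤ ‖x‖ → Δ Ψ x = 0) ∧
        (∀ x : EuclideanSpace ℝ (Fin 3), ‖x‖ ≤ R → ∀ v : EuclideanSpace ℝ (Fin 3),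
            (1 - β) / (3 - β) * (1 + ‖x‖ ^ 2) ^ (-(β / 2)) * ‖v‖ ^ 2 ≤ fderiv ℝ (fderiv ℝ Ψ) x v v ∧
              fderiv ℝ (fderiv ℝ Ψ) x v v ≤ 1 / (3 - β) * (1 + ‖x‖ ^ 2) ^ (-(β / 2)) * ‖v‖ ^ 2) ∧
        (∀ x : EuclideanSpace ℝ (Fin 3), R ≤ ‖x‖ → ∀ v : EuclideanSpace ℝ (Fin 3),
            |fderiv ℝ (fderiv ℝ Ψ) x v v| ≤ C * R ^ (3 - β) / ‖x‖ ^ 3 * ‖v‖ ^ 2) := by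
  intro β hβ hβ1
  refine ⟨2 ^ ((3 - β) / 2) * (4 / (3 - β) + 1), fun R hR => ?_⟩
  have hR0 : 0 < R := by linarith
  -- the cut density, its shell transform and the normalised primitive
  obtain ⟨ρ, hρ, _hρc, hρ0, hρW, hρeq, hρz⟩ := exists_cutDensity hβ hR
  set h : ℝ → ℝ := fun σ => 2⁻¹ * ∫ t in (0 : ℝ)..1, t ^ 2 * ρ (σ * t ^ 2) with hh
  obtain ⟨g, hgs, hg, hga⟩ := exists_primitive (contDiff_shellTransform hρ hh) (2 * R ^ 2)
    (-2 * ((2 * R ^ 2) ^ ((3 : ℝ) / 2) * h (2 * R ^ 2)) * (2 * R ^ 2) ^ (-((1 : ℝ) / 2)))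
  refine ⟨fun w => g (‖w‖ ^ 2), ⟨contDiff_radialBump hgs,
    radialBump_newtonianDecay hβ hR hρ hρ0 hρW hρz hh hg hga⟩, ?_, ?_, ?_, ?_, ?_⟩
  · -- `0 ≤ ΔΨ ≤ w_β`
    intro x
    rw [laplacian_radialBump hρ hh hg x]
    exact ⟨hρ0 _, hρW _ (by positivity)⟩
  · -- `ΔΨ = w_β` on `B_R`
    intro x hx
    rw [laplacian_radialBump hρ hh hg x]
    exact hρeq _ (by positivity) (pow_le_pow_left₀ (norm_nonneg x) hx 2)
  · -- `ΔΨ = 0` off `B_{2R}` (indeed off `B_{√2 R}`)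
    intro x hx
    rw [laplacian_radialBump hρ hh hg x]
    refine hρz _ ?_
    have h4 : (2 * R) ^ 2 ≤ ‖x‖ ^ 2 := pow_le_pow_left₀ (by positivity) hx 2
    nlinarith
  · -- pinching on `B_R`
    intro x hx v
    exact hessian_radialBump_pinched hβ hβ1 hρ hρeq hh hg hx v
  · -- tidal bound outside `B_R`
    intro x hx v
    exact abs_hessian_radialBump_tidal hβ hβ1 hR hρ hρ0 hρW hρz hh hg hx v

end Summit.NavierStokesRegularity.NavierStokesRegularity.Theorems.PowerGaugeEulerLiouville.PressureFloor

end
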